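import Literature.MathematicalPhysics.QuantumFieldTheory.Balaban1983to89.B9SectCLatticeCarrier

/-!
# `Balaban1983to89.B9Eq343ProductCutoffLetters` — T. Bałaban, *Propagators for lattice gauge theories in a background field*, Commun. Math. Phys. **99** (1985)
# 389–434 [Balaban1985BackgroundPropagators] (3.43)–(3.46) p. 398 (localisation of the propagator by smooth cutoffs around unit cubes), (3.23) p. 394:
# **A COORDINATE-PRODUCT CUTOFF INHERITS ITS LATTICE-LIPSCHITZ LETTERS FROM ITS ONE-DIMENSIONAL PROFILES — for `χ(x) = Π_μ p_μ(x_μ)` on the periodic lattice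
# `TSite d N` with `|p_μ| ≤ 1`, the first and second DIFFERENCE-QUOTIENT letters of `B9Eq323KatoCutoffCommutator` §2∕§3 (`|t(χ(x+e_μ) − χ(x))| ≤ c₁`,
# `|t(χ(x) − χ(x−e_μ))| ≤ c₁`, `|t²(2χ(x) − χ(x+e_μ) − χ(x−e_μ))| ≤ c₂`) follow from the SAME letters of the profile `p_μ` alone, direction by direction,
# and `|χ| ≤ 1`, `χ = 1` where every profile is `1`, `χ = 0` where one profile vanishes — the cutoff letters of storey J's assembly
# (`B9Eq342GradientRowAssembly` §3: `hχ1`, `h1p`, `h1m`, `h2`, `hχp`∕`hχt`, `hΩ`) reduced to one-dimensional ones**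

statement-level skeleton of published theorems with citation tags; proofs where landed; nothing here is a claim about the Yang–Mills mass gap

CITATION HEADER (lean-in-tree rule).  Audit cell `pub-balaban`, sub-cell `t4`, BINDER row NE9; filed by NE9 crux-team LEAF PROVER 05
(`b2b-balaban-t4-ne9-formalise-leaf-05`, gen 84).  SOURCE READ first-hand in the held text layer [Balaban1985BackgroundPropagators]
(`paper:balaban1985-cmp99-background-propagators`): p. 398 (3.43)–(3.46) (print localises `G(U)` with smooth functions of the continuum position scaled to the
cubes; on the `η`-lattice such a cutoff is a product of one-dimensional profiles `p_μ(x_μ) = ψ(η x_μ∕r)` whose difference quotients are controlled by `ψ′`, `ψ″` —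
uniformly in `η`, which is the point: a cutoff built from a lattice DISTANCE function has kinks whose second difference quotient is `O(η⁻¹)`, not `O(1)`).  [folklore]
algebra of products; nothing printed is a hypothesis; the `[cite: …]` tags are TEXT LOCATIONS.

WHAT IS PROVED (sorry-free; 0 `def`; [folklore]).  `p : (μ : Fin d) → Fin (N μ) → ℝ` the profiles, the cutoff written out as `fun x => ∏ μ, p μ (x μ)` (no definition).
* §1 `prod_shift_eq`, `prod_unshift_eq` — `χ(x ± e_μ) = p_μ((x ± e_μ)_μ)·Π_{ν ≠ μ} p_ν(x_ν)` and `χ(x) = p_μ(x_μ)·Π_{ν ≠ μ} p_ν(x_ν)`; `abs_prod_erase_le_one` (`|Π_{ν≠μ} p_ν| ≤ 1`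
  when `|p_ν| ≤ 1`).
* §2 **`abs_cutoff_le_one`**, **`first_difference_letter_shift`**, **`first_difference_letter_unshift`**, **`second_difference_letter`** — the three letters of
  `B9Eq323KatoCutoffCommutator` for `χ` from the profile letters `|t(p_μ(k⁺) − p_μ(k))| ≤ c₁`, `|t²(2p_μ(k) − p_μ(k⁺) − p_μ(k⁻))| ≤ c₂` (stated along the lattice
  steps `shift`∕`unshift`, so no successor arithmetic on `Fin (N μ)` is needed).
* §3 **`cutoff_eq_one_of_profiles`**, **`cutoff_eq_zero_of_profile`** — `χ(x) = 1` if every `p_μ(x_μ) = 1`; `χ(x) = 0` if some `p_μ(x_μ) = 0`.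
HONEST SCOPE.  Product algebra only; the one-dimensional profiles (a sampled `C²` bump equal to `1` on the cube's side and `0` beyond the margin `r`, placed inside
one chart of `ℤ∕N_μ`) and their two letters are the consumer's; nothing of [B9] asserted.  NOT summit progress (cell pub-balaban: NE9 NOT PRINTED ∕ NOT PROVED;
«NE9 ⇐ the named binders»; row WALLED ON A MODEL (O-NE9-1; #5 UNRULED); spine PROVED 0∕9; rung (B)+1 finite T⁴ — NOT infinite volume, NOT mass gap, NOT BetaPertH,
NOT Clay).  HONEST DEPENDENCY (cell line): continuum YM on T⁴ ⇐ BetaPertH ∧ nine spine estimates (0/9 proved); BetaPertH ⇐ (D1) ∧ (D4) ∧ CAP+tail; G-an2-4 gates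
asym, D1 and NE2/3/4.  NEW file importing `B9SectCLatticeCarrier` only; nothing modified.  Net new unproved facts: 0.
-/

noncomputable section

open scoped BigOperators

namespace Literature.MathematicalPhysics.QuantumFieldTheory.Balaban1983to89.B9Eq343ProductCutoffLetters

open B4Sect5Torus (TSite)
open B9SectCLatticeCarrier (shift unshift shift_apply_ne unshift_apply_ne)

variable {d : ℕ} {N : Fin d → ℕ}

/-! ## §1 The product along one lattice step -/

/-- `χ(x) = p_μ(x_μ)·Π_{ν ≠ μ} p_ν(x_ν)`. [folklore] [cite: Balaban1985BackgroundPropagators, (3.43) p.398] -/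
theorem prod_eq_mul_prod_erase (p : (μ : Fin d) → Fin (N μ) → ℝ) (x : TSite d N) (μ : Fin d) :
    ∏ ν, p ν (x ν) = p μ (x μ) * ∏ ν ∈ Finset.univ.erase μ, p ν (x ν) :=
  (Finset.mul_prod_erase Finset.univ (fun ν => p ν (x ν)) (Finset.mem_univ μ)).symm

/-- `χ(x + e_μ) = p_μ((x + e_μ)_μ)·Π_{ν ≠ μ} p_ν(x_ν)` (the other coordinates do not move). [folklore] [cite: Balaban1985BackgroundPropagators, (3.43) p.398] -/
theorem prod_shift_eq (p : (μ : Fin d) → Fin (N μ) → ℝ) (x : TSite d N) (μ : Fin d) :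
    ∏ ν, p ν ((shift μ x) ν) = p μ ((shift μ x) μ) * ∏ ν ∈ Finset.univ.erase μ, p ν (x ν) := by
  rw [prod_eq_mul_prod_erase p (shift μ x) μ]
  congr 1
  exact Finset.prod_congr rfl fun ν hν => by rw [shift_apply_ne (Finset.ne_of_mem_erase hν)]

/-- `χ(x − e_μ) = p_μ((x − e_μ)_μ)·Π_{ν ≠ μ} p_ν(x_ν)`. [folklore] [cite: Balaban1985BackgroundPropagators, (3.43) p.398] -/
theorem prod_unshift_eq (p : (μ : Fin d) → Fin (N μ) → ℝ) (x : TSite d N) (μ : Fin d) :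
    ∏ ν, p ν ((unshift μ x) ν) = p μ ((unshift μ x) μ) * ∏ ν ∈ Finset.univ.erase μ, p ν (x ν) := by
  rw [prod_eq_mul_prod_erase p (unshift μ x) μ]
  congr 1
  exact Finset.prod_congr rfl fun ν hν => by rw [unshift_apply_ne (Finset.ne_of_mem_erase hν)]

/-- `|Π_{ν ∈ s} p_ν(x_ν)| ≤ 1` when every `|p_ν| ≤ 1`. [folklore] [cite: Balaban1985BackgroundPropagators, (3.43) p.398] -/
theorem abs_prod_le_one (p : (μ : Fin d) → Fin (N μ) → ℝ) (hp : ∀ μ k, |p μ k| ≤ 1) (x : TSite d N) (s : Finset (Fin d)) :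
    |∏ ν ∈ s, p ν (x ν)| ≤ 1 := by
  rw [Finset.abs_prod]
  exact Finset.prod_le_one (fun ν _ => abs_nonneg _) fun ν _ => hp ν (x ν)

/-! ## §2 The three letters of `B9Eq323KatoCutoffCommutator` for the product cutoff -/

/-- **`|χ(x)| ≤ 1`.** [folklore] [cite: Balaban1985BackgroundPropagators, (3.43) p.398] -/
theorem abs_cutoff_le_one (p : (μ : Fin d) → Fin (N μ) → ℝ) (hp : ∀ μ k, |p μ k| ≤ 1) (x : TSite d N) : |∏ ν, p ν (x ν)| ≤ 1 :=
  abs_prod_le_one p hp x Finset.univ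

/-- **FIRST DIFFERENCE QUOTIENT, FORWARD**: `|t(p_μ((x+e_μ)_μ) − p_μ(x_μ))| ≤ c₁` for all `x` ⟹ `|t(χ(x+e_μ) − χ(x))| ≤ c₁` — the `h1p` letter of
`B9Eq323KatoCutoffCommutator.norm_equiv_covLaplaceSiteK_cutoff_sub_le(_natural)` with `c₁ = c∕r`. [folklore] [cite: Balaban1985BackgroundPropagators, (3.43) p.398, (3.23) p.394] -/
theorem first_difference_letter_shift (p : (μ : Fin d) → Fin (N μ) → ℝ) (hp : ∀ μ k, |p μ k| ≤ 1) (t : ℝ) {c₁ : ℝ}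
    (h1 : ∀ μ (x : TSite d N), |t * (p μ ((shift μ x) μ) - p μ (x μ))| ≤ c₁) (x : TSite d N) (μ : Fin d) :
    |t * (∏ ν, p ν ((shift μ x) ν) - ∏ ν, p ν (x ν))| ≤ c₁ := by
  have hc₁ : 0 ≤ c₁ := (abs_nonneg _).trans (h1 μ x)
  rw [prod_shift_eq, prod_eq_mul_prod_erase p x μ, ← sub_mul, ← mul_assoc, abs_mul]
  calc |t * (p μ ((shift μ x) μ) - p μ (x μ))| * |∏ ν ∈ Finset.univ.erase μ, p ν (x ν)| ≤ c₁ * 1 :=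
        mul_le_mul (h1 μ x) (abs_prod_le_one p hp x _) (abs_nonneg _) hc₁
    _ = c₁ := mul_one _

/-- **FIRST DIFFERENCE QUOTIENT, BACKWARD**: `|t(p_μ(x_μ) − p_μ((x−e_μ)_μ))| ≤ c₁` ⟹ `|t(χ(x) − χ(x−e_μ))| ≤ c₁` (the `h1m` letter). [folklore]
[cite: Balaban1985BackgroundPropagators, (3.43) p.398, (3.23) p.394] -/
theorem first_difference_letter_unshift (p : (μ : Fin d) → Fin (N μ) → ℝ) (hp : ∀ μ k, |p μ k| ≤ 1) (t : ℝ) {c₁ : ℝ}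
    (h1 : ∀ μ (x : TSite d N), |t * (p μ (x μ) - p μ ((unshift μ x) μ))| ≤ c₁) (x : TSite d N) (μ : Fin d) :
    |t * (∏ ν, p ν (x ν) - ∏ ν, p ν ((unshift μ x) ν))| ≤ c₁ := by
  have hc₁ : 0 ≤ c₁ := (abs_nonneg _).trans (h1 μ x)
  rw [prod_unshift_eq, prod_eq_mul_prod_erase p x μ, ← sub_mul, ← mul_assoc, abs_mul]
  calc |t * (p μ (x μ) - p μ ((unshift μ x) μ))| * |∏ ν ∈ Finset.univ.erase μ, p ν (x ν)| ≤ c₁ * 1 :=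
        mul_le_mul (h1 μ x) (abs_prod_le_one p hp x _) (abs_nonneg _) hc₁
    _ = c₁ := mul_one _

/-- **SECOND DIFFERENCE QUOTIENT**: `|t²(2p_μ(x_μ) − p_μ((x+e_μ)_μ) − p_μ((x−e_μ)_μ))| ≤ c₂` ⟹ `|t²(2χ(x) − χ(x+e_μ) − χ(x−e_μ))| ≤ c₂` — the `h2` letter with
`c₂ = c∕r²`; t-free exactly when the PROFILE's second difference quotient is (a sampled `C²` bump: `c₂ = ‖ψ″‖_∞`). [folklore]
[cite: Balaban1985BackgroundPropagators, (3.43) p.398, (3.23) p.394] -/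
theorem second_difference_letter (p : (μ : Fin d) → Fin (N μ) → ℝ) (hp : ∀ μ k, |p μ k| ≤ 1) (t : ℝ) {c₂ : ℝ}
    (h2 : ∀ μ (x : TSite d N), |t ^ 2 * (2 * p μ (x μ) - p μ ((shift μ x) μ) - p μ ((unshift μ x) μ))| ≤ c₂) (x : TSite d N) (μ : Fin d) :
    |t ^ 2 * (2 * ∏ ν, p ν (x ν) - ∏ ν, p ν ((shift μ x) ν) - ∏ ν, p ν ((unshift μ x) ν))| ≤ c₂ := by
  have hc₂ : 0 ≤ c₂ := (abs_nonneg _).trans (h2 μ x)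
  have e : t ^ 2 * (2 * ∏ ν, p ν (x ν) - ∏ ν, p ν ((shift μ x) ν) - ∏ ν, p ν ((unshift μ x) ν)) =
      (t ^ 2 * (2 * p μ (x μ) - p μ ((shift μ x) μ) - p μ ((unshift μ x) μ))) * ∏ ν ∈ Finset.univ.erase μ, p ν (x ν) := by
    rw [prod_shift_eq, prod_unshift_eq, prod_eq_mul_prod_erase p x μ]; ring
  rw [e, abs_mul]
  calc |t ^ 2 * (2 * p μ (x μ) - p μ ((shift μ x) μ) - p μ ((unshift μ x) μ))| * |∏ ν ∈ Finset.univ.erase μ, p ν (x ν)| ≤ c₂ * 1 :=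
        mul_le_mul (h2 μ x) (abs_prod_le_one p hp x _) (abs_nonneg _) hc₂
    _ = c₂ := mul_one _

/-! ## §3 Where the cutoff is `1` and where it vanishes -/

/-- **`χ(x) = 1` where every profile is `1`** (the cube proper: the `hχp`∕`hχt` letters at the output bond's ends). [folklore] [cite: Balaban1985BackgroundPropagators, (3.43) p.398] -/
theorem cutoff_eq_one_of_profiles (p : (μ : Fin d) → Fin (N μ) → ℝ) (x : TSite d N) (h : ∀ μ, p μ (x μ) = 1) : ∏ ν, p ν (x ν) = 1 :=
  Finset.prod_eq_one fun ν _ => h ν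

/-- **`χ(x) = 0` where one profile vanishes** (off the margin: the `hΩ` letter's support condition, coordinate by coordinate). [folklore]
[cite: Balaban1985BackgroundPropagators, (3.43) p.398] -/
theorem cutoff_eq_zero_of_profile (p : (μ : Fin d) → Fin (N μ) → ℝ) (x : TSite d N) (μ : Fin d) (h : p μ (x μ) = 0) : ∏ ν, p ν (x ν) = 0 :=
  Finset.prod_eq_zero (Finset.mem_univ μ) h

end Literature.MathematicalPhysics.QuantumFieldTheory.Balaban1983to89.B9Eq343ProductCutoffLetters

end
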